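import Literature.Topology.FourManifolds.ToricBlowupProjectivePlane
import Literature.Topology.FourManifolds.ConnectedSumData
import HarnessLib

/-!
# Blowing up a plumbing point: the Kervaire–Milnor identities in the affine charts of `ℂℙ²`

Topic `Literature/Topology/FourManifolds`; companion of `BlowUpLineCapTube.lean` (block 2 of
Akhmedov–Park's `X₁(m)`, A. Akhmedov, B. D. Park, Invent. Math. 181 (2010), §3, "blow up at the
double point": the blow-up of a `4`-manifold at a point is its connected sum with `ℂℙ²bar`,
McDuff–Salamon (2017), Exercise 7.1.4 (ii); the proper transforms of the two coordinate lines are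
disjoint lines, ibid. Example 7.1.9).  In the tree's Kervaire–Milnor form of the connected sum
(`Literature.Topology.FourManifolds.ConnectedSumData`, `Literature.Topology.FourManifolds.discInversionFun`:
`t • u ∼ (1 - t) • u` between the punctured unit balls of a chart at the point and of the affine
chart `affineChart 2` of `ℂℙ²` at `q = [0 : 0 : 1]`), this file proves the three identities used to
continue the two sheets `{(a, 0)}`, `{(0, b)}` (complex plumbing coordinates `(a, b) = toC2 z` of
`ℝ⁴`, `Literature.Topology.FourManifolds.ToricBlowup.toC2`) and their product tubes into `ℂℙ²`:

* `affineChart_two_symm_discInversion_sheetTube` — **the tube of the first sheet seen in the chart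
  at `[1 : 0 : 0]`**: for `a ≠ 0` and `‖a‖ s < 1`, `s = √(1 + ‖ν‖²)`, the Kervaire–Milnor partner of
  the tube point `z = (a, a ν)` (`‖z‖ = ‖a‖ s`) is
  `[((1 - ‖z‖)/‖z‖) a : ((1 - ‖z‖)/‖z‖) a ν : 1] = [1 : ν : conj â • s/(1 - ‖a‖ s)]`, the point with
  chart-`0` coordinates `(ν, conj â • s/(1 - ‖a‖ s))` — the far-zone value of the cap tube of
  `BlowUpLineCapTube.lean` (the framing of the sheet turns once along the way: `1/(λ a) = conj â/(λ ‖a‖)`);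
* `affineChart_zero_symm_fromC2_ne_one_symm` — **the two caps are disjoint**: a point
  `[1 : ν : K]` of the first cap's tube never equals a point `[ν′ : 1 : K′]` of the second
  (`‖ν‖ ‖ν′‖ < 1` excludes `ν ν′ = 1`), in particular the proper transforms `{w₁ = 0}` and its
  analogue are disjoint ("two disjoint lines");
* `affineChart_zero_symm_ne_qPt` — cap points are never the removed centre `q`.

Everything is proved; no definitions, no named facts.

## References

* D. McDuff, D. Salamon, *Introduction to Symplectic Topology*, 3rd ed. (2017), Exercise 7.1.4 (ii),
  Example 7.1.9. [McDuffSalamon2017]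
* M. Kervaire, J. Milnor, *Groups of homotopy spheres I*, Ann. of Math. 77 (1963), §2.
  [KervaireMilnor1963]
* A. Akhmedov, B. D. Park, Invent. Math. 181 (2010) 577–603, §3. [AkhmedovPark2010]
-/

noncomputable section

open scoped Topology ComplexConjugate
open Set Function Complex
open Literature.Topology.FourManifolds.ToricBlowup
open Literature.Topology.FourManifolds.ComplexProjectiveSpace

namespace Literature.Topology.FourManifolds

namespace BlowUpCap

/-! ### The tube point of the first sheet and its Kervaire–Milnor partner -/

/-- `‖(a, a ν)‖ = ‖a‖ √(1 + ‖ν‖²)` in `ℝ⁴`. [folklore] -/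
theorem norm_fromC2_sheetTube (a ν : ℂ) :
    ‖fromC2 (a, a * ν)‖ = ‖a‖ * Real.sqrt (1 + ‖ν‖ ^ 2) := by
  have h : ‖fromC2 (a, a * ν)‖ ^ 2 = (‖a‖ * Real.sqrt (1 + ‖ν‖ ^ 2)) ^ 2 := by
    rw [norm_fromC2_sq, Complex.normSq_eq_norm_sq, Complex.normSq_eq_norm_sq, norm_mul, mul_pow,
      mul_pow, Real.sq_sqrt (by positivity)]
    ring
  exact (pow_left_inj₀ (norm_nonneg _) (by positivity) two_ne_zero).1 h

/-- Kervaire–Milnor's inversion of the tube point: `ψ (a, a ν) = (λ a, λ a ν)`,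
`λ = (1 - ‖a‖ s)/(‖a‖ s)`. [cite: KervaireMilnor1963, §2] -/
theorem discInversionFun_fromC2_sheetTube (a ν : ℂ) :
    discInversionFun (fromC2 (a, a * ν)) =
      fromC2 ((((1 - ‖a‖ * Real.sqrt (1 + ‖ν‖ ^ 2)) * (‖a‖ * Real.sqrt (1 + ‖ν‖ ^ 2))⁻¹ : ℝ) : ℂ) * a,
        (((1 - ‖a‖ * Real.sqrt (1 + ‖ν‖ ^ 2)) * (‖a‖ * Real.sqrt (1 + ‖ν‖ ^ 2))⁻¹ : ℝ) : ℂ) *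
          (a * ν)) := by
  apply toC2_injective
  rw [discInversionFun, norm_fromC2_sheetTube, toC2_smul, toC2_fromC2, toC2_fromC2]

/-- The projective scaling `[λ a : λ a ν : 1] = [1 : ν : (λ a)⁻¹]` (`λ a ≠ 0`). [folklore] -/
theorem pt_sheetTube_eq {a ν : ℂ} {μ : ℝ} (ha : a ≠ 0) (hμ : μ ≠ 0)
    (h1 : (![((μ : ℝ) : ℂ) * a, ((μ : ℝ) : ℂ) * (a * ν), 1] : Fin 3 → ℂ) ≠ 0)
    (h2 : (![1, ν, (((μ : ℝ) : ℂ) * a)⁻¹] : Fin 3 → ℂ) ≠ 0) :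
    pt ![((μ : ℝ) : ℂ) * a, ((μ : ℝ) : ℂ) * (a * ν), 1] h1 = pt ![1, ν, (((μ : ℝ) : ℂ) * a)⁻¹] h2 := by
  have hμc : ((μ : ℝ) : ℂ) ≠ 0 := Complex.ofReal_ne_zero.2 hμ
  have hμa : ((μ : ℝ) : ℂ) * a ≠ 0 := mul_ne_zero hμc ha
  refine pt_eq_pt_of_smul h1 h2 (((μ : ℝ) : ℂ) * a) ?_
  funext j
  fin_cases j
  · simp
  · simp; ring
  · simp; field_simp

/-- `(λ a)⁻¹ = conj â • (λ ‖a‖)⁻¹`: inverting turns the phase over. [folklore] -/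
theorem inv_real_mul_eq (a : ℂ) (μ : ℝ) :
    (((μ : ℝ) : ℂ) * a)⁻¹ = conj (((‖a‖⁻¹ : ℝ) : ℂ) * a) * (((μ * ‖a‖)⁻¹ : ℝ) : ℂ) := by
  rcases eq_or_ne a 0 with rfl | ha
  · simp
  rcases eq_or_ne μ 0 with rfl | hμ
  · simp
  have hn : (‖a‖ : ℝ) ≠ 0 := norm_ne_zero_iff.2 ha
  have hu : (((‖a‖⁻¹ : ℝ) : ℂ) * a) * conj (((‖a‖⁻¹ : ℝ) : ℂ) * a) = 1 := by
    rw [Complex.mul_conj, Complex.normSq_eq_norm_sq, norm_mul, Complex.norm_real, norm_inv, norm_norm,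
      inv_mul_cancel₀ hn]
    norm_num
  have hsplit : ((μ : ℝ) : ℂ) * a = ((μ * ‖a‖ : ℝ) : ℂ) * (((‖a‖⁻¹ : ℝ) : ℂ) * a) := by
    have : ((‖a‖ : ℝ) : ℂ) ≠ 0 := Complex.ofReal_ne_zero.2 hn
    push_cast
    field_simp
  symm
  apply eq_inv_of_mul_eq_one_left
  rw [hsplit]
  calc conj (((‖a‖⁻¹ : ℝ) : ℂ) * a) * (((μ * ‖a‖)⁻¹ : ℝ) : ℂ) *
        (((μ * ‖a‖ : ℝ) : ℂ) * (((‖a‖⁻¹ : ℝ) : ℂ) * a))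
      = ((((‖a‖⁻¹ : ℝ) : ℂ) * a) * conj (((‖a‖⁻¹ : ℝ) : ℂ) * a)) *
          ((((μ * ‖a‖)⁻¹ : ℝ) : ℂ) * ((μ * ‖a‖ : ℝ) : ℂ)) := by ring
    _ = 1 := by
        rw [hu, one_mul, ← Complex.ofReal_mul, inv_mul_cancel₀ (mul_ne_zero hμ hn), Complex.ofReal_one]

/-- **The first sheet's tube point in the chart at `[1 : 0 : 0]`.**  For `a ≠ 0` and `‖a‖ s < 1`,
`s = √(1 + ‖ν‖²)`, the Kervaire–Milnor partner `(affineChart 2)⁻¹ (ψ (a, a ν))` of the tube point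
`(a, a ν)` of the sheet `{(a, 0)}` is the point `(affineChart 0)⁻¹ (ν, conj â • s/(1 - ‖a‖ s))`, i.e.
`[1 : ν : conj â • s/(1 - ‖a‖ s)]` — the far-zone value of the cap tube.
[cite: KervaireMilnor1963, §2] [cite: McDuffSalamon2017, Example 7.1.9] -/
theorem affineChart_two_symm_discInversion_sheetTube {a ν : ℂ} (ha : a ≠ 0)
    (hlt : ‖a‖ * Real.sqrt (1 + ‖ν‖ ^ 2) < 1) :
    (affineChart (n := 2) 2).symm (discInversionFun (fromC2 (a, a * ν))) =
      (affineChart (n := 2) 0).symm (fromC2 (ν, conj (((‖a‖⁻¹ : ℝ) : ℂ) * a) *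
        (Real.sqrt (1 + ‖ν‖ ^ 2) / (1 - ‖a‖ * Real.sqrt (1 + ‖ν‖ ^ 2)) : ℝ))) := by
  set s : ℝ := Real.sqrt (1 + ‖ν‖ ^ 2) with hs
  have hs1 : 1 ≤ s := Real.one_le_sqrt.2 (by nlinarith [norm_nonneg ν])
  have hn : 0 < ‖a‖ := norm_pos_iff.2 ha
  have has : 0 < ‖a‖ * s := by positivity
  set μ : ℝ := (1 - ‖a‖ * s) * (‖a‖ * s)⁻¹ with hμ
  have hμ0 : μ ≠ 0 := mul_ne_zero (by linarith) (inv_ne_zero has.ne')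
  rw [discInversionFun_fromC2_sheetTube, affineChart_two_symm, toC2_fromC2, affineChart_zero_symm,
    toC2_fromC2]
  simp only
  rw [pt_sheetTube_eq ha hμ0 _ (vec3_ne_zero 0 (by simp)), ]
  apply pt_congr
  rw [inv_real_mul_eq]
  have hd : 1 - ‖a‖ * s ≠ 0 := by linarith
  have hs0 : s ≠ 0 := by linarith
  have h3 : (((μ * ‖a‖)⁻¹ : ℝ) : ℂ) = ((s / (1 - ‖a‖ * s) : ℝ) : ℂ) := by
    congr 1
    rw [hμ]
    field_simp
  rw [h3]

/-! ### The caps are disjoint and avoid `q` -/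

/-- Points of the chart at `[1 : 0 : 0]` are never the removed centre `q = [0 : 0 : 1]`.
[folklore] -/
theorem affineChart_zero_symm_ne_qPt (w : EuclideanSpace ℝ (Fin 4)) : (affineChart (n := 2) 0).symm w ≠ qPt := by
  rw [affineChart_zero_symm, Ne, pt_eq_qPt_iff]
  simp

/-- Points of the chart at `[0 : 1 : 0]` are never `q`. [folklore] -/
theorem affineChart_one_symm_ne_qPt (w : EuclideanSpace ℝ (Fin 4)) : (affineChart (n := 2) 1).symm w ≠ qPt := by
  rw [affineChart_one_symm, Ne, pt_eq_qPt_iff]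
  simp

/-- **The tubes of the two caps are disjoint**: `[1 : ν : K] = [ν′ : 1 : K′]` forces `ν ν′ = 1`,
impossible for `‖ν‖ ‖ν′‖ < 1`.  (The proper transforms of the two coordinate lines are disjoint:
McDuff–Salamon, Example 7.1.9.) [cite: McDuffSalamon2017, Example 7.1.9] -/
theorem affineChart_zero_symm_fromC2_ne_one_symm {ν K ν' K' : ℂ} (h : ‖ν‖ * ‖ν'‖ < 1) :
    (affineChart (n := 2) 0).symm (fromC2 (ν, K)) ≠ (affineChart (n := 2) 1).symm (fromC2 (ν', K')) := by
  rw [affineChart_zero_symm, affineChart_one_symm, toC2_fromC2, toC2_fromC2]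
  intro heq
  obtain ⟨c, -, hcv⟩ := exists_smul_of_pt_eq _ _ heq
  have h0 := congr_fun hcv 0
  have h1 := congr_fun hcv 1
  simp at h0 h1
  -- `h0 : c * ν' = 1`, `h1 : c = ν`
  have hνν : ‖ν‖ * ‖ν'‖ = 1 := by
    rw [← norm_mul, ← h1, h0, norm_one]
  linarith

end BlowUpCap

end Literature.Topology.FourManifolds
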